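import Summits.NavierStokesRegularity.NavierStokesRegularity.Theses.PlaneEnergyCeiling
import Literature.Analysis.FluidPDE.BlowupAncientSolutionProofs
import Literature.Analysis.FluidPDE.SelfSimilarLiouville
import Literature.Analysis.FluidPDE.KNSSLiouvilleBridge

/-!
# Disproof of `PlanarEnergyLiouville` — findings: NO KILL (crux-attack cycle 1); open Liouville
# problem implied by KNSS (L); planar clause load-bearing (constants); smoothness clause load-bearing
# as typed (null-set spike vs the pointwise conclusion); measurability clause redundant

Crux work file of `PlaneEnergyCeiling.PlanarEnergyLiouville` (stmt-NavierStokesRegularity-16856, rank 3,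
hypothesis `h₃` of the route's `closes`), opened by the crux-attack seat
`refuter-rattack-stmt-NavierStokesRegularity-16856-0`, 2026-08-17 (one cycle of basic attacks; there
was no earlier Disproof.lean). Everything below is sorry-free, standard axioms. §1, §3 and §5 are
also filed for the tree as `Theorems/PlanarEnergyLiouville/Negative/PlanarBoundLoadBearing.lean`
(proposal id in the item evidence note). A later cdisprove seat EXTENDS this file (do not restart it).

The crux: a bounded ancient mild solution `v` of NS (`ν = 1`, KNSS duality class
`IsBoundedAncientMildSolution 1 v`) with measurable slices, jointly `C^∞` on `(−∞,0) × ℝ³`, whose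
planar kinetic energies `∫_{R({x₂=c})} |v(t)|² dA` are bounded uniformly in `t, R, c`, vanishes
identically on `t < 0`.

Attacks run and their outcome:
* ELABORATION: rc 0 by name and verbatim; the signature elaborates standalone with only
  `import Mathlib` + `Literature.Analysis.FluidPDE.SelfSimilar` (the gate notes "does not elaborate
  standalone in the context of Theorems/X.lean" are missing-import artefacts of those files).
  Read-back: `lintegral` of `‖·‖ₑ²` over `volume` on `EuclideanSpace ℝ (Fin 2)` (no Bochner junk);
  `M : ℝ` under `ofReal` (harmless under `∃`); `R` over ALL linear isometries and `c : ℝ` = all affine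
  planes; `∃ M` BEFORE `∀ t < 0` (uniform in time, as the informal text says); `IsBoundedOn (Iio 0)`
  is a uniform sup bound up to `t → 0⁻`; conclusion pointwise on `t < 0` (joint smoothness makes
  a.e. information pointwise). The duality identity's Bochner-junk convention is NOT exploitable:
  for `v` bounded and jointly continuous every integrand in `IsMildNSSolutionBetween` is integrable
  and `τ`-measurable.
* TRIVIALITY: `exact?`, `simp_all`, `aesop` fail on the crux; the bare conclusion is false (`v`
  arbitrary); hypotheses satisfiable (§2) — the crux is neither trivial nor vacuous.
* RESTATES-THE-SUMMIT: `C → S` fails `exact?` (it is `closes` given `PlanarEnergyAPriori` and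
  `PlanarEnergyZoomA`); `S → C` fails `exact?` and on paper (Clay (A) for Schwartz data says nothing
  about ancient solutions). Instead `(L) → C` (§4, filed contrapositively as
  `not_liouvilleConjectureNS_of_not_crux`: a kill of the crux disproves (L)): the crux is implied
  by the KNSS Liouville conjecture `LiouvilleConjectureNS` (bounded ancient mild + measurable slices
  ⇒ slice-wise a.e. constant), because continuous slices a.e. equal to a constant are constant and
  nonzero constants have infinite planar energy (§3). So `C` sits inside the (L)-circle of open
  problems.
* HYPOTHESIS MUTATION: planar bound dropped ⇒ FALSE (§3, constants `e₀`; equally the parasitic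
  drifts `b(t)`, in tree `AncientMildDrift`); measurability dropped ⇒ EQUIVALENT statement (§1: a
  jointly smooth field has continuous, hence measurable, slices); smoothness dropped ⇒ FALSE AS
  TYPED (§5: the null-set spike `e₀·𝟙_{x=0}` is slice-wise a.e. zero, hence in the duality class by
  `IsBoundedAncientMildSolution.congr_ae_slice`, measurable, all planar energies `0`, not pointwise
  zero) — the clause licenses the POINTWISE conclusion; the smoothness-free variant with conclusion
  `v t =ᵐ 0` is untouched and morally equivalent (KNSS: bounded mild ancient solutions are `C^∞`
  in `x` after modification, time-roughness enters only through `b(t)`, which the planar bound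
  kills); boundedness dropped ⇒ no cheap witness.
* KNOWN EXPLICIT ANCIENT SOLUTIONS, all excluded: constants / `b(t)` (planar energy `⊤`, §3);
  shear flows `(f(x₂,t),0,0)` (bounded ancient caloric `f` is constant); 2D and 2.5D flows (a plane
  containing the invariant direction has infinite energy unless the trace vanishes); Beltrami /
  Trkalian `e^{-λ²t}W` and Oseen/Burgers vortices (unbounded as `t → −∞`, or 2D, or linear growth);
  harmonic potential flows `∇h(x,t)` (bounded ⇒ constant); Landau solutions (singular, planar
  energy through the origin log-divergent).
* SELF-SIMILAR CORNER (correction of the earlier route-review note "backward (D)SS excluded by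
  boundedness"): `u(x,t) = (T−t)^{-1/2} U(x/√(T−t))` with blow-up time `T > 0` IS bounded on
  `(−∞,0)` (`|u| ≤ ‖U‖_∞/√T`), ancient, smooth, and its planar sup equals that of `U` (exact scale
  invariance of the planar energy). So the crux CONTAINS "no backward self-similar blow-up with a
  bounded smooth profile of bounded planar energies" — and that corner is IN PRINT: a smooth bounded
  Leray profile is constant (Tsai 1998, `U ∈ L^∞ ⇒ U ≡ const`; Chae–Wolf, ARMA 2017 =
  arXiv:1609.06962, Thm 1.2 with Remark 1.3, read p. 3), hence zero under the planar bound. Not a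
  kill; briefing for the prover (the DSS corner: Chae–Wolf, CPDE 2017, "Removing discretely
  self-similar singularities").
* CHEAPEST FALSIFIER: not finite / decidable; a kill needs a NONZERO bounded, jointly smooth ancient
  mild solution on `ℝ³ × (−∞,0)` with `sup_{t,planes} ∫_Π |v|² < ∞` — it would refute KNSS (L)
  (open since 2009; no non-constant bounded ancient mild solution of 3D NS on the whole space is
  known at all, steady ones included) and no candidate family exists to compute with. No compute
  job. VERDICT: survives.

Remark (size of the class, for ideators): bounded + planar-`L²` is NOT inside any Lebesgue class —
a sum of divergence-free unit bumps with sparse centres in general position (no four centres in a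
common slab of width 2, e.g. centres `λ^k ω_k` with generic directions `ω_k`; any plane's unit
neighbourhood then meets at most three bumps) is bounded, smooth, has planar energies `≤ 3 ×` (one
bump) and infinite `L^p` norm for every `p < ∞`; the free structure is exactly of `L^∞ ∩ Ṁ^{2,3}`
type (a ball lies in a slab), with no smallness at infinity and no decay along sparse directions.
-/

noncomputable section

open MeasureTheory Set Function Filter Topology
open scoped InnerProductSpace RealInnerProductSpace ContDiff ENNReal
open Literature.Analysis.FluidPDE

namespace Summit.NavierStokesRegularity.NavierStokesRegularity.Cruxes.PlanarEnergyLiouville.Disproof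

open Summit.NavierStokesRegularity.NavierStokesRegularity.Theses.PlaneEnergyCeiling

local notation "E3" => EuclideanSpace ℝ (Fin 3)
local notation "E2" => EuclideanSpace ℝ (Fin 2)

/-! ## §0 The crux, compact form -/

/-- The planar-bound clause of the crux, as a predicate on a time-dependent field. [folklore] -/
def PlanarBound (v : ℝ → E3 → E3) : Prop :=
  ∃ M : ℝ, ∀ t < 0, ∀ (R : E3 ≃ₗᵢ[ℝ] E3) (c : ℝ),
    ∫⁻ y : E2, ‖v t (R (WithLp.toLp 2 ![y 0, y 1, c]))‖ₑ ^ 2 ≤ ENNReal.ofReal M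

/-- The joint-smoothness clause of the crux. [folklore] -/
def SmoothOnSlab (v : ℝ → E3 → E3) : Prop :=
  ContDiffOn ℝ (⊤ : ℕ∞) (Function.uncurry v) (Set.Iio 0 ×ˢ Set.univ)

/-- The crux reads: bounded ancient mild (ν = 1) + measurable slices + jointly smooth + planar bound
⇒ `v ≡ 0` on `t < 0`. [folklore] -/
theorem crux_iff :
    PlanarEnergyLiouville ↔
      ∀ v : ℝ → E3 → E3, IsBoundedAncientMildSolution 1 v →
        (∀ t < 0, AEStronglyMeasurable (v t) volume) → SmoothOnSlab v → PlanarBound v →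
          ∀ t < 0, ∀ x, v t x = 0 :=
  Iff.rfl

/-! ## §1 Slices of a jointly smooth field are continuous: the measurability clause is decoration -/

/-- A field jointly smooth on `(−∞,0) × ℝ³` has continuous slices at every `t < 0`. [folklore] -/
theorem continuous_slice {v : ℝ → E3 → E3} (hsm : SmoothOnSlab v) {t : ℝ} (ht : t < 0) :
    Continuous (v t) := by
  have hc : ContinuousOn (Function.uncurry v) (Set.Iio 0 ×ˢ Set.univ) := hsm.continuousOn
  have h2 : Continuous fun x : E3 => Function.uncurry v (t, x) :=
    hc.comp_continuous (by fun_prop) (fun x => ⟨ht, Set.mem_univ _⟩)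
  simpa [Function.uncurry] using h2

/-- Hence the slices are (a.e. strongly) measurable: hypothesis 2 of the crux follows from
hypothesis 3. [folklore] -/
theorem aestronglyMeasurable_slice {v : ℝ → E3 → E3} (hsm : SmoothOnSlab v) :
    ∀ t < 0, AEStronglyMeasurable (v t) (volume : Measure E3) :=
  fun _ ht => (continuous_slice hsm ht).aestronglyMeasurable

/-- **The measurability clause is redundant**: the crux is equivalent to the same statement with
the clause `∀ t < 0, AEStronglyMeasurable (v t) volume` dropped. [folklore] -/
theorem crux_iff_without_measurability :
    PlanarEnergyLiouville ↔
      ∀ v : ℝ → E3 → E3, IsBoundedAncientMildSolution 1 v → SmoothOnSlab v → PlanarBound v →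
        ∀ t < 0, ∀ x, v t x = 0 :=
  ⟨fun h v hv hsm hpl => h v hv (aestronglyMeasurable_slice hsm) hsm hpl,
    fun h v hv _ hsm hpl => h v hv hsm hpl⟩

/-! ## §2 Vacuity: the hypotheses are satisfiable (by the zero field), the instance is "true → true" -/

/-- The zero field satisfies all four hypotheses of the crux (with `M = 0`). [folklore] -/
theorem hyps_zero :
    IsBoundedAncientMildSolution 1 (fun (_ : ℝ) (_ : E3) => (0 : E3)) ∧
      (∀ t < (0 : ℝ), AEStronglyMeasurable ((fun (_ : ℝ) (_ : E3) => (0 : E3)) t) (volume : Measure E3)) ∧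
      SmoothOnSlab (fun (_ : ℝ) (_ : E3) => (0 : E3)) ∧
      PlanarBound (fun (_ : ℝ) (_ : E3) => (0 : E3)) := by
  refine ⟨isBoundedAncientMildSolution_fun_const 1 0, fun t _ => aestronglyMeasurable_const,
    contDiffOn_const, 0, fun t _ R c => ?_⟩
  simp

/-! ## §3 Load-bearing clause: the planar bound (constants) -/

/-- **Planar energy of a nonzero constant is infinite**: `∫⁻ over ℝ² of ‖b‖ₑ² = ⊤` (Lebesgue
measure of the plane is infinite). [folklore] -/
theorem lintegral_enorm_sq_const_eq_top {b : E3} (hb : b ≠ 0) :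
    ∫⁻ _ : E2, ‖b‖ₑ ^ 2 = ⊤ := by
  have hne : ‖b‖ₑ ^ 2 ≠ 0 := pow_ne_zero _ (by rwa [enorm_ne_zero])
  simp only [lintegral_const, measure_univ_of_isAddLeftInvariant]
  exact ENNReal.mul_top hne

/-- The same on every plane `R({x₂ = c})` for the constant field `x ↦ b`. [folklore] -/
theorem planarEnergy_const_eq_top {b : E3} (hb : b ≠ 0) (R : E3 ≃ₗᵢ[ℝ] E3) (c : ℝ) :
    ∫⁻ y : E2, ‖(fun _ : E3 => b) (R (WithLp.toLp 2 ![y 0, y 1, c]))‖ₑ ^ 2 = ⊤ := by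
  beta_reduce
  exact lintegral_enorm_sq_const_eq_top hb

/-- **Tightness of the planar clause on constants**: a constant-in-space field satisfies the planar
bound iff it vanishes at every `t < 0` — the clause excludes exactly the KNSS constants / parasitic
drifts `b(t)` and nothing less. [folklore] -/
theorem planarBound_const_iff (b : ℝ → E3) :
    PlanarBound (fun t _ => b t) ↔ ∀ t < 0, b t = 0 := by
  constructor
  · rintro ⟨M, hM⟩ t ht
    by_contra hb
    have hle := hM t ht (LinearIsometryEquiv.refl ℝ E3) 0
    beta_reduce at hle
    rw [lintegral_enorm_sq_const_eq_top hb] at hle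
    exact ENNReal.ofReal_ne_top (top_le_iff.1 hle)
  · intro h
    refine ⟨0, fun t ht R c => ?_⟩
    simp [h t ht]

/-- **LOAD-BEARING (the planar bound).** The crux with the planar-bound clause DROPPED is FALSE:
the constant field `e₀` is a bounded ancient mild solution (KNSS 2009 §1), measurable, jointly
smooth, and nonzero. Any proof of the crux must use the planar bound (it is what excludes the
constants and the parasitic drifts `b(t)` of the Liouville conjecture (L)). [folklore] -/
theorem false_without_planarBound :
    ¬ (∀ v : ℝ → E3 → E3, IsBoundedAncientMildSolution 1 v →
        (∀ t < 0, AEStronglyMeasurable (v t) (volume : Measure E3)) → SmoothOnSlab v →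
          ∀ t < 0, ∀ x, v t x = 0) := by
  intro h
  have h1 := h (fun _ _ => EuclideanSpace.single 0 1) (isBoundedAncientMildSolution_fun_const 1 _)
    (fun t _ => aestronglyMeasurable_const) contDiffOn_const (-1) (by norm_num) 0
  have h0 := congrArg (fun w : E3 => w 0) h1
  simp at h0

/-! ## §4 The crux follows from the KNSS Liouville conjecture (L): a kill of the crux disproves (L) -/

/-- **(L) ⇒ crux, stated negatively: a counterexample to the crux refutes `LiouvilleConjectureNS`**
(KNSS 2009 (L), as vendored: bounded ancient mild solutions with measurable slices are slice-wise
a.e. constant). Given (L), a continuous slice a.e. equal to a constant IS that constant, and a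
nonzero constant has infinite planar energy (§3), so the crux holds; contrapositively any witness
against the crux is a non-constant bounded ancient mild solution. So the crux is at most as hard as
(L) and is NOT a restatement of the summit (`S → C` and `C → S` both fail `exact?`; `C → S` is the
route's `closes` given the other two cruxes). [folklore] -/
theorem not_liouvilleConjectureNS_of_not_crux (hC : ¬ PlanarEnergyLiouville) :
    ¬ LiouvilleConjectureNS := by
  intro hL
  apply hC
  intro v hv hmeas hsm hpl t ht x
  obtain ⟨b, hb⟩ := hL v hv hmeas t ht
  have hcont : Continuous (v t) := continuous_slice hsm ht
  have heq : v t = fun _ => b := (Continuous.ae_eq_iff_eq volume hcont continuous_const).1 hb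
  have hpl' : PlanarBound (fun s _ => if s = t then b else 0) := by
    obtain ⟨M, hM⟩ := hpl
    refine ⟨max M 0, fun s hs R c => ?_⟩
    by_cases hst : s = t
    · subst hst
      have := hM s hs R c
      simp only [heq] at this
      simp only [if_true]
      exact this.trans (ENNReal.ofReal_le_ofReal (le_max_left _ _))
    · simp [hst]
  have hb0 := (planarBound_const_iff _).1 hpl' t ht
  simp only [if_true] at hb0
  rw [heq, hb0]

/-! ## §5 Load-bearing clause AS TYPED: smoothness (null-set spike against the pointwise conclusion) -/

/-- **LOAD-BEARING AS TYPED (the smoothness clause, through the pointwise conclusion).**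
`PlaneEnergyCeiling.PlanarEnergyLiouville` with its joint-smoothness clause DROPPED (everything
else verbatim) is FALSE, by a null-set modification of the zero solution: the field equal to `e₀`
at the origin and `0` elsewhere (all times) is slice-wise a.e. zero — hence a bounded ancient mild
solution (`IsBoundedAncientMildSolution.congr_ae_slice`: every clause of the duality class is a
slice integral), with measurable slices and ALL planar energies `0` (a plane meets the origin in at
most one point, a null set of the plane) — but it is not pointwise zero. So the smoothness clause
is what licenses the POINTWISE conclusion `∀ t < 0, ∀ x, v t x = 0`; the variant without
smoothness and with the a.e. conclusion `v t =ᵐ 0` is untouched by this witness (and is the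
morally equivalent open statement: KNSS 2009 — bounded mild ancient solutions have a representative
smooth in `x`). [folklore] -/
theorem false_without_smoothness :
    ¬ (∀ (v : ℝ → EuclideanSpace ℝ (Fin 3) → EuclideanSpace ℝ (Fin 3)),
        Literature.Analysis.FluidPDE.IsBoundedAncientMildSolution 1 v →
        (∀ t < 0, MeasureTheory.AEStronglyMeasurable (v t) MeasureTheory.volume) →
        (∃ M : ℝ, ∀ t < 0, ∀ (R : EuclideanSpace ℝ (Fin 3) ≃ₗᵢ[ℝ] EuclideanSpace ℝ (Fin 3)) (c : ℝ),
          ∫⁻ y : EuclideanSpace ℝ (Fin 2), ‖v t (R (WithLp.toLp 2 ![y 0, y 1, c]))‖ₑ ^ 2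
            ≤ ENNReal.ofReal M) →
        ∀ t < 0, ∀ x, v t x = 0) := by
  intro h
  -- the witness: `e₀` at the origin, `0` elsewhere
  set w : ℝ → EuclideanSpace ℝ (Fin 3) → EuclideanSpace ℝ (Fin 3) :=
    fun _ x => if x = 0 then EuclideanSpace.single 0 1 else 0 with hw
  -- slice-wise a.e. equal to the zero field
  have hae : ∀ t : ℝ, w t =ᵐ[volume] fun _ => (0 : EuclideanSpace ℝ (Fin 3)) := by
    intro t
    have h0 : ({0}ᶜ : Set (EuclideanSpace ℝ (Fin 3))) ∈ ae (volume : Measure (EuclideanSpace ℝ (Fin 3))) :=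
      compl_mem_ae_iff.2 (measure_singleton (0 : EuclideanSpace ℝ (Fin 3)))
    filter_upwards [h0] with x hx
    simp only [mem_compl_iff, mem_singleton_iff] at hx
    simp [hw, hx]
  -- bounded by 1
  have hwb : IsBoundedOn (Iio 0) w := by
    refine ⟨1, fun t _ x => ?_⟩
    by_cases hx : x = 0
    · simp [hw, hx]
    · simp [hw, hx]
  -- hence a bounded ancient mild solution with measurable slices
  have hmild : IsBoundedAncientMildSolution 1 w :=
    (isBoundedAncientMildSolution_fun_const 1 (0 : EuclideanSpace ℝ (Fin 3))).congr_ae_slice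
      (fun t _ => hae t) hwb
  have hmeas : ∀ t < 0, AEStronglyMeasurable (w t) (volume : Measure (EuclideanSpace ℝ (Fin 3))) :=
    fun t _ => (aestronglyMeasurable_const (b := (0 : EuclideanSpace ℝ (Fin 3)))).congr (hae t).symm
  -- every planar energy vanishes: the plane point `(y₀, y₁, c)` is the origin only at `y = 0`
  have hplane : ∀ {y : EuclideanSpace ℝ (Fin 2)} {c : ℝ},
      (WithLp.toLp 2 ![y 0, y 1, c] : EuclideanSpace ℝ (Fin 3)) = 0 → y = 0 := by
    intro y c hyc
    have h0 := congrArg (fun z : EuclideanSpace ℝ (Fin 3) => z 0) hyc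
    have h1 := congrArg (fun z : EuclideanSpace ℝ (Fin 3) => z 1) hyc
    simp at h0 h1
    ext i
    fin_cases i <;> simp [h0, h1]
  have hpl : ∃ M : ℝ, ∀ t < 0, ∀ (R : EuclideanSpace ℝ (Fin 3) ≃ₗᵢ[ℝ] EuclideanSpace ℝ (Fin 3)) (c : ℝ),
      ∫⁻ y : EuclideanSpace ℝ (Fin 2), ‖w t (R (WithLp.toLp 2 ![y 0, y 1, c]))‖ₑ ^ 2
        ≤ ENNReal.ofReal M := by
    refine ⟨0, fun t _ R c => ?_⟩
    have h0 : ({0}ᶜ : Set (EuclideanSpace ℝ (Fin 2))) ∈ ae (volume : Measure (EuclideanSpace ℝ (Fin 2))) :=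
      compl_mem_ae_iff.2 (measure_singleton (0 : EuclideanSpace ℝ (Fin 2)))
    have hzero : (fun y : EuclideanSpace ℝ (Fin 2) => ‖w t (R (WithLp.toLp 2 ![y 0, y 1, c]))‖ₑ ^ 2)
        =ᵐ[volume] fun _ => 0 := by
      filter_upwards [h0] with y hy
      simp only [mem_compl_iff, mem_singleton_iff] at hy
      have hne : R (WithLp.toLp 2 ![y 0, y 1, c]) ≠ 0 := by
        intro hR
        have hp : (WithLp.toLp 2 ![y 0, y 1, c] : EuclideanSpace ℝ (Fin 3)) = 0 := by
          simpa using congrArg R.symm hR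
        exact hy (hplane hp)
      simp [hw, hne]
    rw [lintegral_congr_ae hzero, lintegral_zero]
    exact zero_le
  -- but the field is `e₀ ≠ 0` at the origin at `t = -1`
  have h1 := h w hmild hmeas hpl (-1) (by norm_num) 0
  have h10 := congrArg (fun z : EuclideanSpace ℝ (Fin 3) => z 0) h1
  simp [hw] at h10

end Summit.NavierStokesRegularity.NavierStokesRegularity.Cruxes.PlanarEnergyLiouville.Disproof

end
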